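/-
Copyright (c) 2026 the pub-hodgecm-mathlib formalisation cell (harness21).  Prover seat hodgecm-mathlib-F0P3-p01 (g32), Track A «(D-RAM) FOUR-FRAME», unit U2H, census leaf
(ρ2b′-X) — T5b «toric level census, type RamK», anisotropic side: WHEN the twisted norm-depth sets are inhabited (organ B3).  2026-09-04.
-/
import Literature.NumberTheory.LocalFields.QuadraticOrderNormDepthIndexTwo   -- ★ p857360 (this seat): `[Ũ : N(U)] = 2`, `exists_depth_not_norm_of_le`, `exists_mul_map_eq_of_depth_of_le`, `mem_map_normHom_iff`
import HarnessLib

/-!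
# Twisted norm-depth sets of a ramified quadratic datum: inhabited iff `c + 2 ≤ 2d`
(Serre, *Local Fields* Ch. V §3; Jacobowitz 1962 §4)

Topic `NumberTheory/LocalFields`; namespace `Literature.NumberTheory.LocalFields.QuadraticOrder`.  THEOREMS ONLY (no definition, no instance, no notation, no named fact, no
`sorry`); kernel lane `--supports stmt-HodgeConjecture-24833` (count-neutral).  Cell `pub/hodgecm-mathlib` (D-0151), crux H413, Track A, unit U2H, census leaf (ρ2b′-X), type RamK,
ANISOTROPIC side: the side scalar is `h₋ = h₊·n₀` with `n₀` a `Θ`-fixed unit which is NOT a norm `ωΘω`, and the level counts (★ `Theorems/F0P3cDyRamToricLevelCensusRamK` ED. 2)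
take as binders whether some unit `ω` has TWISTED depth `|n₀·ωΘω − ρ(n₀·ωΘω)| ≤ exp(−c)`.  THIS FILE discharges them for a ramified quadratic datum `(Θ, ϖ, d, t)` over a complete
field with finite residue field: **`exists_twistedNormDepth_le_of_le`** — if `c + 2 ≤ 2d` such an `ω` exists (★ `exists_depth_not_norm_of_le` gives a non-norm `Θ`-fixed unit of
depth `≤ exp(−c)`; two non-norm classes agree since `[Ũ : N(U)] = 2`); **`not_twistedNormDepth_le_of_le`** — if `2d ≤ c + 1` no unit has twisted depth `≤ exp(−c)` (★
`exists_mul_map_eq_of_depth_of_le`: every `Θ`-fixed unit that deep is a norm, so `n₀` would be one), under the token `hFN` (every doubly-fixed unit is a norm; discharged in the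
third-field frame by ★ `QuadraticDatumNormsOfDoublyFixedUnitsThirdField`).
HONEST LABEL: HC_CM is proved only modulo the 7 printed citations (2 remaining named inputs: hLiu418 = stmt-HodgeConjecture-24832, h413 = stmt-HodgeConjecture-24833) until rung 0
closes; unconditional local algebra, count-neutral.

## References
* [Serre1979] J.-P. Serre, *Local Fields*, GTM 67 (1979): Ch. V §3 (norm groups of ramified quadratic extensions).
* [Jacobowitz1962] R. Jacobowitz, *Hermitian forms over local fields*, Amer. J. Math. 84 (1962): §4.
-/

set_option autoImplicit false

open WithZero
open scoped Valued

namespace Literature.NumberTheory.LocalFields.QuadraticOrder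

open Literature.NumberTheory.Automorphic.UnitaryThreeFourFrame
open Literature.NumberTheory.LocalFields.WildQuadraticDatum

variable {K : Type} [Field K] [Valued K ℤᵐ⁰] {ρ Θ : K →+* K} {α : K}

/-- **A TWISTED DEPTH SET BELOW `2d − 2` IS INHABITED**: for a ramified quadratic datum `(Θ, ϖ, d, t)`, a `Θ`-fixed non-norm unit `n₀` and `c + 2 ≤ 2d`, some unit `ω` has
`|n₀·ωΘω − ρ(n₀·ωΘω)| ≤ exp(−c)`. [cite: Serre1979, Ch. V §3 Cor. 3] [cite: Jacobowitz1962, §4] -/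
theorem exists_twistedNormDepth_le_of_le [CompleteSpace K] [Finite 𝓀[K]] (hvρ : ∀ x, Valued.v (ρ x) = Valued.v x)
    {ϖ : K} {d t : ℕ} (hD : IsRamifiedQuadraticDatum Θ ϖ d t) {n₀ : K} (hΘn : Θ n₀ = n₀) (hn1 : Valued.v n₀ = 1) (hnN : ¬ ∃ ω : K, ω * Θ ω = n₀)
    {c : ℕ} (hc : c + 2 ≤ 2 * d) :
    ∃ ω : K, Valued.v ω = 1 ∧ Valued.v (n₀ * (ω * Θ ω) - ρ (n₀ * (ω * Θ ω))) ≤ exp (-(c : ℤ)) := by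
  have hvΘ : ∀ x, Valued.v (Θ x) = Valued.v x := hD.2.1
  obtain ⟨u, hΘu, hu1, huc, huN⟩ := exists_depth_not_norm_of_le (ρ := ρ) hvρ hD hc
  -- the unit group `U`, its `Θ`-fixed part `Ũ`, the norm subgroup `N(U)` (index 2 in `Ũ`)
  obtain ⟨U, hU⟩ : ∃ U : Subgroup Kˣ, ∀ u, u ∈ U ↔ Valued.v (u : K) = 1 := by
    refine ⟨{ carrier := {u : Kˣ | Valued.v (u : K) = 1}, mul_mem' := ?_, one_mem' := ?_, inv_mem' := ?_ }, fun u => Iff.rfl⟩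
    · intro a b ha hb
      rw [Set.mem_setOf_eq] at ha hb ⊢
      rw [Units.val_mul, map_mul, ha, hb, mul_one]
    · rw [Set.mem_setOf_eq, Units.val_one, map_one]
    · intro a ha
      rw [Set.mem_setOf_eq] at ha ⊢
      rw [Units.val_inv_eq_inv_val, map_inv₀, ha, inv_one]
  obtain ⟨Ut, hUt⟩ := exists_subgroup_thetaFixed_units (K := K) (Θ := Θ)
  have hidx : ((U.map (MonoidHom.id Kˣ * Units.map (Θ : K →* K))).subgroupOf Ut).index = 2 := by
    rw [← Subgroup.relIndex]; exact map_normHom_units_relIndex_eq_two hD hU hUt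
  have hn0 : n₀ ≠ 0 := fun h0 => by rw [h0, map_zero] at hn1; exact zero_ne_one hn1
  have hu0 : u ≠ 0 := fun h0 => by rw [h0, map_zero] at hu1; exact zero_ne_one hu1
  -- both `n₀⁻¹` and `u` are non-norm classes in `Ũ`, so `n₀⁻¹·u` is a norm
  have hnUt : (⟨Units.mk0 n₀ hn0, (hUt _).2 ⟨by rw [Units.val_mk0]; exact hΘn, by rw [Units.val_mk0]; exact hn1⟩⟩ : Ut)⁻¹ ∉
      (U.map (MonoidHom.id Kˣ * Units.map (Θ : K →* K))).subgroupOf Ut := by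
    rw [Subgroup.inv_mem_iff, Subgroup.mem_subgroupOf, mem_map_normHom_iff hvΘ hU (by rw [Units.val_mk0]; exact hn1), Units.val_mk0]; exact hnN
  have huUt : (⟨Units.mk0 u hu0, (hUt _).2 ⟨by rw [Units.val_mk0]; exact hΘu, by rw [Units.val_mk0]; exact hu1⟩⟩ : Ut) ∉
      (U.map (MonoidHom.id Kˣ * Units.map (Θ : K →* K))).subgroupOf Ut := by
    rw [Subgroup.mem_subgroupOf, mem_map_normHom_iff hvΘ hU (by rw [Units.val_mk0]; exact hu1), Units.val_mk0]; exact huN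
  have hprod := (Subgroup.mul_mem_iff_of_index_two hidx).2 (iff_of_false hnUt huUt)
  rw [Subgroup.mem_subgroupOf, Subgroup.coe_mul, Subgroup.coe_inv,
    mem_map_normHom_iff hvΘ hU (by rw [Units.val_mul, Units.val_inv_eq_inv_val, Units.val_mk0, Units.val_mk0, map_mul, map_inv₀, hn1, hu1, inv_one, one_mul]),
    Units.val_mul, Units.val_inv_eq_inv_val, Units.val_mk0, Units.val_mk0] at hprod
  obtain ⟨ω, hω⟩ := hprod
  have hω1 : Valued.v ω = 1 := v_eq_one_of_mul_map_eq hvΘ (by rw [map_mul, map_inv₀, hn1, hu1, inv_one, one_mul]) hω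
  refine ⟨ω, hω1, ?_⟩
  rw [hω, mul_inv_cancel_left₀ hn0]
  exact huc

/-- **NO TWISTED DEPTH SET AT OR ABOVE `2d − 1`**: for a ramified quadratic datum with the doubly-fixed-norm token `hFN`, a `Θ`-fixed non-norm unit `n₀` and `2d ≤ c + 1`, NO unit
`ω` has `|n₀·ωΘω − ρ(n₀·ωΘω)| ≤ exp(−c)` (else `n₀·ωΘω`, a `Θ`-fixed unit that deep, is a norm, and so is `n₀`). [cite: Serre1979, Ch. V §3] [cite: Jacobowitz1962, §4] -/
theorem not_twistedNormDepth_le_of_le [CompleteSpace K] (hρρ : ∀ x, ρ (ρ x) = x) (hvρ : ∀ x, Valued.v (ρ x) = Valued.v x) (hα1 : Valued.v α ≤ 1)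
    (hδ : Valued.v (α - ρ α) = 1) (hΘρ : ∀ x, Θ (ρ x) = ρ (Θ x)) {ϖ : K} {d t : ℕ} (hD : IsRamifiedQuadraticDatum Θ ϖ d t) (hρϖ : ρ ϖ = ϖ)
    (hFN : ∀ f : K, ρ f = f → Θ f = f → Valued.v f = 1 → ∃ x : K, x * Θ x = f)
    {n₀ : K} (hΘn : Θ n₀ = n₀) (hn1 : Valued.v n₀ = 1) (hnN : ¬ ∃ ω : K, ω * Θ ω = n₀) {c : ℕ} (hc : 2 * d ≤ c + 1)
    (ω : K) (hω : Valued.v ω = 1) : ¬ Valued.v (n₀ * (ω * Θ ω) - ρ (n₀ * (ω * Θ ω))) ≤ exp (-(c : ℤ)) := by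
  intro hle
  have hΘΘ : ∀ x, Θ (Θ x) = x := hD.1
  have hvΘ : ∀ x, Valued.v (Θ x) = Valued.v x := hD.2.1
  have hΘz : Θ (n₀ * (ω * Θ ω)) = n₀ * (ω * Θ ω) := by rw [map_mul, map_mul, hΘn, hΘΘ, mul_comm (Θ ω) ω]
  have hz1 : Valued.v (n₀ * (ω * Θ ω)) = 1 := by rw [map_mul, map_mul, hn1, hvΘ, hω, one_mul, one_mul]
  obtain ⟨ω', hω'⟩ := exists_mul_map_eq_of_depth_of_le hρρ hvρ hα1 hδ hΘρ hD hρϖ hFN hc hΘz hz1 hle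
  have hω0 : ω ≠ 0 := fun h0 => by rw [h0, map_zero] at hω; exact zero_ne_one hω
  have hΘω0 : Θ ω ≠ 0 := (map_ne_zero Θ).2 hω0
  refine hnN ⟨ω' / ω, ?_⟩
  rw [map_div₀, div_mul_div_comm, hω', mul_div_assoc, div_self (mul_ne_zero hω0 hΘω0), mul_one]

end Literature.NumberTheory.LocalFields.QuadraticOrder
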